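import Summits.BirchSwinnertonDyer.Rank1Residual.X11b.AtomA1SelmerCertificate
import HarnessLib

/-!
# Class X11b, the `p² ∣ #Ш_an` rows: the LOWER certificate from an EXHIBITED subgroup of the
# `p`-Selmer group — `p^(rank + j)` Selmer classes suffice, the EXACT count `#Sel^(p) = p^(rank + j)`
# (GRH-free class-group certification) is NOT needed

HONEST FRAMING (cell `b2b-bsdres-*`, run/shared/lean/b2b/bsd-rank1-residual/, verbatim): the goal
of the cell is to DELETE the COMBINATION-SHAPED residual classes for ALL analytic-rank `≤ 1` elliptic
curves over `ℚ` — "full BSD formula for every rank `≤ 1` curve in class C" assembled STRICTLY from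
published theorems — so that the rank-`≤ 1` remainder becomes exactly the CONSTRUCTION-SHAPED
classes, which are TYPED (missing-input Props), NOT attempted; this is not "finishing BSD".
Unit `b2b-bsdres-x11b` (X11 prover B, `p = 3`), gen 11. Class X11b and X11 ∧ `r = 1` ∧ `p = 3` stay
CONSTRUCTION-SHAPED (REFEREE R6.2); this file is PER PAIR (a certificate shape), not a class
theorem; THEOREMS ONLY (no definition, no named fact, no `sorry`); nothing is booked here (the lane
books).

## What this file does

The two per-pair closing shapes of the cell for a rank-one pair `(E,p)` with `ord_p #Ш(E)_an = j ≥ 1`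
— `SelmerRankOne.lean` (UPPER half = Kolyvagin / Cha at a Heegner datum with `ord_p [E(K):ℤy_K] ≤ 1`)
and `AtomA1SelmerCertificate.lean` (UPPER half UNCONDITIONAL on the atom A1 = (ram) ∧ `p ∤ ∏c_ℓ`) —
take the LOWER half from the EXACT `p`-descent count `#Sel^(p)(E/ℚ) = p^(1+j)`. Producing that
equality GRH-free means CERTIFYING the class group of the degree-`p²−1` étale algebra of `E[p] ∖ 0`
(PARI `bnfcertify` up to a Zimmert-type bound `≈ 10⁻³·√|d_A|`): for the X11b@3 tail classes this is
`2·10⁴ – 4·10⁵` core-seconds per class and, for `|d_A| ≳ 2·10²⁵`, beyond the compute pool's 48-hour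
wall (two classes of record: `338919c1`, `433686p1`; X11B-AUDIT §19.16).

But the LOWER half only ever uses the INEQUALITY `#Ш(E/ℚ)[p] ≥ p^j`, and that follows from any
EXHIBITED subgroup `S ≤ Sel^(p)(E/ℚ)` of order `p^(rank + j)` — e.g. the span of `rank + j` explicitly
given, independent Selmer classes, each of which is checked to be a Selmer class by FINITE LOCAL
computations (no class group, no GRH):

* §1 (any number field `K`, any rank): **`S ≤ Sel^(p)(E/K)`, `#S = p^(rank E(K) + j)`, `E(K)[p] = 0`
  ⇒ `p^j ∣ #Ш(E/K)`** (`pow_dvd_shaOrder_of_card_addSubgroup_selmerGroup`). Proof: in the PROVED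
  fundamental exact sequence `0 → E(K)/pE(K) → Sel^(p)(E/K) → Ш(E/K)[p] → 0` (`selmer_exact_holds`,
  Silverman AEC X.4.2(a)) the kernel has order dividing `[E(K):pE(K)] = p^{rank}·#E(K)[p] = p^{rank}`
  (tree theorem `index_range_zsmul_eq_pow_rank_mul_card_torsionBy`, Mordell–Weil), hence IS `p^a`
  with `a ≤ rank`; Lagrange gives `p^(rank+j) = #S ∣ #Sel^(p) = p^a · #Ш(E/K)[p]`, so
  `p^(rank+j−a) ∣ #Ш(E/K)[p]` and `p^j ∣ #Ш(E/K)[p] ∣ #Ш(E/K)` (`Nat.card`, junk `0` if infinite — no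
  finiteness is used). The exact-count theorem `pow_dvd_shaOrder_of_card_selmerGroup` is the case
  `S = Sel^(p)`.
* §2 (over `ℚ`): the two closing shapes with the certificate binder
  `#Sel^(p)(E/ℚ) = p^(1+j)` REPLACED by `S ≤ Sel^(p)(E/ℚ)`, `#S = p^(1+j)`:
  `bsdp_of_kolyvagin_of_card_addSubgroup_selmer` (Kolyvagin index road, `ρ̄` onto) and
  `bsdp_of_classX11b_of_ram_of_not_dvd_of_card_addSubgroup_selmer` (atom A1, NO index — the
  sub-cell `x11b3`'s UNCONDITIONAL Euler-system half `missingUpperBoundAt_of_classX11b_of_ram_of_not_dvd`).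
  (Cha's index road `bsdp_of_mult_of_cha_of_card_selmer` weakens the same way; not needed by any
  row of record, omitted.)
* §3: the `p = 3` rows (`ClassX11b W 3` / `IsX11Three` / `ClassX11 W 3`), `#S = 27`, `ord₃ #Ш_an ≤ 2`.

Where it bites (numbers, not adjectives; EVIDENCE pointers — `HOME/b2b-bsdres-x11b/tail10/tail_strata.tsv`,
`HOME/b2b-bsdres-x11b/sel3x5e5/CLOSING_x11b3_5e5.tsv`, X11B-AUDIT §19–§20; nothing booked here): of
the lane's 20 798 X11b@3 rank-one residue classes at `N < 5·10⁵`, 82 have `#Ш_an = 9`; ALL 33 of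
them in the gen-10 TAIL lie on the atom A1 (a (ram) prime, `3 ∤ ∏c_ℓ`) with `ρ̄_{E,3}` onto and three
independent `3`-Selmer classes exhibited by the gen-8 GRH census; 3 of the 33 received the EXACT
certificate in gen 10 (55–111 ks each), `338919c1` was wall-killed at 48 h, `433686p1` (79 h
predicted) was never run, 28 were conditional strata. With this file the 30 open ones need only the
exhibited subgroup of order `27` (seconds per class, GRH-free by verification of the three classes).

References: Silverman AEC X.4.2 [SilvermanAEC2009]; Schaefer–Stoll 2004 §1, §5 (the `p`-Selmer group
inside `A^×/(A^×)^p`; Selmer classes are certified by local images) [SchaeferStoll2004]; McCallum 1991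
§1 [McCallumLMS1991]; Gross 1991 Thm. 1.3 [GrossLMS1991]; Skinner 2016 Thm. C [Skinner2016PacificMC]; Hoffstein–Luo 1997 [HoffsteinLuo1997]; Mazur 1977 III.§5 [Mazur1977]; Miller
2011 Def. 1.1 [Miller2011LMS]; cell files `X11b/SelmerRankOne.lean` (x11b gen 9),
`X11b/AtomA1SelmerCertificate.lean` (x11b3-p5), `X11b/BDPRouteOddPrimeClass.lean` (multr1-p2).
-/

noncomputable section

open scoped Classical

open WeierstrassCurve Literature.NumberTheory.EllipticCurves
  Literature.NumberTheory.EllipticCurves.ModularForms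
  Literature.NumberTheory.EllipticCurves.Rank1Residual
  Literature.NumberTheory.EllipticCurves.Rank1Residual.Typed
open NumberField IsDedekindDomain

namespace Summit.BirchSwinnertonDyer.Rank1Residual.X11b

/-! ### §1. An exhibited subgroup of `Sel^(p)(E/K)` of order `p^(rank + j)` gives `p^j ∣ #Ш(E/K)` -/

section Lower

variable {K : Type} [Field K] [NumberField K] (W : WeierstrassCurve K) [W.IsElliptic]
  (p : ℕ) [Fact p.Prime]

/-- **An EXHIBITED Selmer subgroup as a LOWER bound for `Ш`**: over a number field `K`, if
`S ≤ Sel^(p)(E/K)` is a subgroup with `#S = p ^ (rank E(K) + j)` and `E(K)[p] = 0`, then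
`p ^ j ∣ #Ш(E/K)`. Proof: by the fundamental exact sequence (`selmer_exact_holds`) the map
`Sel^(p) → H¹(K,E)` has kernel of order dividing `[E(K):pE(K)] = p^{rank}·#E(K)[p] = p^{rank}`
(Mordell–Weil), so of order `p^a` with `a ≤ rank`, and image `Ш(E/K)[p]`; Lagrange gives
`p^(rank+j) = #S ∣ #Sel^(p) = p^a·#Ш(E/K)[p]`, whence `p^j ∣ p^(rank+j−a) ∣ #Ш(E/K)[p] ∣ #Ш(E/K)`
(`Nat.card`; no finiteness needed). This is the shape in which `rank + j` explicitly given,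
independent classes of `A^×/(A^×)^p`, each verified to be a Selmer class by its local images
(Schaefer–Stoll), certify `dim_{𝔽_p} Ш(E/K)[p] ≥ j` WITHOUT the class group of `A` (no GRH, no
`bnfcertify`); the exact count (`pow_dvd_shaOrder_of_card_selmerGroup`, `SelmerRankOne.lean`) is the
case `S = Sel^(p)` (`le_rfl`). [cite: SilvermanAEC2009, Thm. X.4.2(a) and Thm. VIII.6.7]
[cite: SchaeferStoll2004, §1 and §5 (the `p`-Selmer group as the subgroup of `A^×/(A^×)^p` cut out by local images)] -/
theorem pow_dvd_shaOrder_of_card_addSubgroup_selmerGroup {j : ℕ}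
    {S : AddSubgroup (W.galH1Torsion (p : ℤ))} (hS : S ≤ W.selmerGroup (p : ℤ))
    (hcardS : Nat.card S = p ^ (W.mordellWeilRank + j))
    (htors : Nat.card (AddSubgroup.torsionBy W.toAffine.Point (p : ℤ)) = 1) :
    p ^ j ∣ W.shaOrder := by
  have hp : p.Prime := Fact.out
  have hp0 : (p : ℤ) ≠ 0 := by exact_mod_cast hp.ne_zero
  obtain ⟨κ, hker, hrange, hmap⟩ := selmer_exact_holds W (p : ℤ) hp0
  -- `#im κ = [E(K) : pE(K)] = p ^ rank`
  have hcardR : Nat.card κ.range = p ^ W.mordellWeilRank := by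
    have h1 : Nat.card (W.toAffine.Point ⧸ κ.ker) = Nat.card κ.range :=
      Nat.card_congr (QuotientAddGroup.quotientKerEquivRange κ).toEquiv
    have h2 : Nat.card (W.toAffine.Point ⧸ κ.ker) = κ.ker.index := rfl
    rw [← h1, h2, hker, index_range_zsmul_eq_pow_rank_mul_card_torsionBy W hp.ne_zero, htors,
      mul_one]
  -- `g : Sel^(p) → H¹(K, E)`, the restriction of `H¹(K, E[p]) → H¹(K, E)`
  set Sel : AddSubgroup (W.galH1Torsion (p : ℤ)) := W.selmerGroup (p : ℤ) with hSel
  set g : Sel →+ W.galH1 := (W.torsionH1ToH1 (p : ℤ)).comp Sel.subtype with hg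
  have hgr : g.range = W.sha ⊓ AddSubgroup.torsionBy W.galH1 (p : ℤ) := by
    rw [hg, AddMonoidHom.range_comp, AddSubgroup.range_subtype, hmap]
  -- `ker g ↪ im κ`
  have hkerle : g.ker.map Sel.subtype ≤ κ.range := by
    intro x hx
    obtain ⟨y, hy, rfl⟩ := AddSubgroup.mem_map.mp hx
    rw [hrange]
    refine AddSubgroup.mem_inf.mpr ⟨y.2, ?_⟩
    rw [AddMonoidHom.mem_ker] at hy ⊢
    simpa [hg] using hy
  have hkdvd : Nat.card g.ker ∣ p ^ W.mordellWeilRank := by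
    rw [← hcardR, ← AddSubgroup.card_map_of_injective (K := g.ker) Sel.subtype_injective]
    exact AddSubgroup.card_dvd_of_le hkerle
  -- so `#ker g = p ^ a` with `a ≤ rank`
  obtain ⟨a, ha, hka⟩ := (Nat.dvd_prime_pow hp).mp hkdvd
  -- Lagrange: `p ^ (rank + j) = #S ∣ #Sel = #ker g · #im g = p ^ a · #im g`
  have hSdvd : p ^ (W.mordellWeilRank + j) ∣ Nat.card Sel := by
    rw [← hcardS]
    exact AddSubgroup.card_dvd_of_le hS
  have hmul : Nat.card g.ker * Nat.card g.range = Nat.card Sel := by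
    rw [← Nat.card_congr (QuotientAddGroup.quotientKerEquivRange g).toEquiv, mul_comm,
      ← AddSubgroup.card_eq_card_quotient_mul_card_addSubgroup]
  have h1 : p ^ a * p ^ (W.mordellWeilRank + j - a) ∣ p ^ a * Nat.card g.range := by
    rw [← pow_add, show a + (W.mordellWeilRank + j - a) = W.mordellWeilRank + j by omega, ← hka,
      hmul]
    exact hSdvd
  -- hence `p ^ j ∣ p ^ (rank + j - a) ∣ #im g`
  have hrdvd : p ^ j ∣ Nat.card g.range :=
    (pow_dvd_pow p (by omega : j ≤ W.mordellWeilRank + j - a)).trans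
      (Nat.dvd_of_mul_dvd_mul_left (pow_pos hp.pos a) h1)
  -- and `im g = Ш(E/K)[p] ≤ Ш(E/K)`
  calc p ^ j ∣ Nat.card g.range := hrdvd
    _ ∣ W.shaOrder := by
        rw [hgr, WeierstrassCurve.shaOrder]
        exact AddSubgroup.card_dvd_of_le inf_le_left

/-- **Rank-one reading: a subgroup `S ≤ Sel^(p)(E/K)` of order `p³`, `rank E(K) = 1`, `E(K)[p] = 0`
⇒ `p² ∣ #Ш(E/K)`** — three independent exhibited Selmer classes give `Ш(E/K)[p] ⊇ (ℤ/p)²`.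
[cite: SilvermanAEC2009, Thm. X.4.2(a)] -/
theorem sq_dvd_shaOrder_of_card_addSubgroup_selmerGroup_eq_cube
    {S : AddSubgroup (W.galH1Torsion (p : ℤ))} (hS : S ≤ W.selmerGroup (p : ℤ))
    (hcardS : Nat.card S = p ^ 3) (hrank : W.mordellWeilRank = 1)
    (htors : Nat.card (AddSubgroup.torsionBy W.toAffine.Point (p : ℤ)) = 1) :
    p ^ 2 ∣ W.shaOrder :=
  pow_dvd_shaOrder_of_card_addSubgroup_selmerGroup W p (j := 2) hS (by rw [hrank]; exact hcardS) htors

end Lower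

/-! ### §2. The two per-pair closing shapes over `ℚ` with the subgroup certificate -/

section Assembly

variable (W : WeierstrassCurve ℚ) [W.IsElliptic] (p : ℕ) [Fact p.Prime]

/-- **Rank one, odd `p`, `ρ̄_{E,p}` onto, `ord_p #Ш_an = 2`: `BSD(E,p)` from PUBLISHED theorems plus
the Heegner-index certificate `ord_p [E(K) : ℤ y_K] ≤ 1` (UPPER half, Kolyvagin in McCallum's /
Gross's printed form) and an EXHIBITED subgroup `S ≤ Sel^(p)(E/ℚ)` of order `p³` (LOWER half, §1)** —
`bsdp_of_kolyvagin_of_card_selmer` of `SelmerRankOne.lean` with its exact-count binder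
`#Sel^(p)(E/ℚ) = p³` weakened to the subgroup. `E(ℚ)[p] = 0` is automatic (onto ⇒ irreducible ⇒ no
rational `p`-torsion, Mazur); GZK gives `rank E(ℚ) = r_an = 1` and `Ш(E/ℚ)` finite. Per pair; NOT a
class theorem; the lane certifies. [cite: McCallumLMS1991, §1 Theorem (Kolyvagin), p. 296]
[cite: GrossLMS1991, §1 Thm. 1.3 (2), p. 236] [cite: SilvermanAEC2009, Thm. X.4.2(a)]
[cite: Miller2011LMS, §1 and Def. 1.1] [cite: Mazur1977, Ch. III §5, p. 157] -/
theorem bsdp_of_kolyvagin_of_card_addSubgroup_selmer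
    (hGZK : rank_eq_analyticRank_of_analyticRank_le_one)
    {N : ℕ} [NeZero N] {K : Type} [Field K] [NumberField K] (hKo : kolyvagin N W K)
    (hB : Kolyvagin1990_padicValNat_card_sha_le N W K) (hK : IsImaginaryQuadratic K)
    (hH : SatisfiesHeegnerHypothesis N K) {P : (W.baseChange K).toAffine.Point}
    (hP : IsHeegnerPoint N W K P) (hnt : ¬ IsOfFinAddOrder P)
    (hp2 : p ≠ 2) (hρ : W.HasSurjectiveModNGaloisRep p)
    (hI : padicValNat p (AddSubgroup.zmultiples P).index ≤ 1)
    (hr : W.analyticRank = 1) {s : ℚ} (hs : shaAn W = (s : ℂ)) (hv : padicValRat p s = 2)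
    {S : AddSubgroup (W.galH1Torsion (p : ℤ))} (hS : S ≤ W.selmerGroup (p : ℤ))
    (hcardS : Nat.card S = p ^ 3) :
    BSDp W p := by
  obtain ⟨hrk, hfin⟩ := hGZK W (by omega)
  have hirr : Irr W p := hasIrreducibleModPGaloisRep_of_hasSurjectiveModNGaloisRep W p hρ
  -- LOWER half: `p² ∣ #Ш(E/ℚ)` from the exhibited subgroup
  have hdvd : p ^ 2 ∣ W.shaOrder :=
    sq_dvd_shaOrder_of_card_addSubgroup_selmerGroup_eq_cube W p hS hcardS (by rw [hrk, hr])
      ((natCard_torsionBy_point_eq_of_subsingleton W _ _ _).trans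
        (natCard_torsionBy_eq_one_of_hasIrreducibleModPGaloisRep W p hirr))
  have hlow : MissingLowerBoundAt W p :=
    missingLowerBoundAt_of_sq_dvd W p hfin hs hv.le hdvd
  -- UPPER half: Kolyvagin
  have hup : MissingUpperBoundAt W p :=
    missingUpperBoundAt_of_padicValNat_shaOrder_le W p (k := 1)
      (padicValNat_shaOrder_le_of_kolyvagin W p hKo hB hK hH hP hnt hp2 hρ hfin hI)
      hs (by rw [hv]; norm_num)
  exact bsdp_of_missingPPartAt W p hGZK (by omega) (missingPPartAt_of_lower_of_upper W p hlow hup)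

end Assembly

section AtomA1

/-- **X11b ∧ (ram) ∧ `p ∤ ∏c_ℓ`, EVERY ODD PRIME: `BSD(E,p)` from PUBLISHED theorems plus ONE
certificate — an EXHIBITED subgroup `S ≤ Sel^(p)(E/ℚ)` of order `p^(1+j)` — with `ord_p #Ш(E)_an ≤ j`;
NO Heegner index, NO partner curve, NO Cassels–Tate, NO class-group certification.** UPPER half: the
sub-cell's UNCONDITIONAL `missingUpperBoundAt_of_classX11b_of_ram_of_not_dvd` (Kolyvagin 1990 Thm. A at
the Hoffstein–Luo / Manin-good Heegner datum, Gross–Zagier bookkeeping against Skinner 2016 Thm. C for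
the rank-zero twist — the ten published named facts `hGZ hKo hB hSk hGZK hmod hnf hHL hMaz hNS`);
LOWER half: §1 (`rank E(ℚ) = r_an = 1` by GZK; `E(ℚ)[p] = 0` since `E[p]` is irreducible, Mazur),
fed to `bsdp_of_classX11b_of_ram_of_not_dvd_of_pow_dvd`. Sub-class statement with a per-pair
certificate; nothing booked. [cite: JetchevSkinnerWan2017, §7.4.2 (p. 31)]
[cite: McCallumLMS1991, §1 Theorem (Kolyvagin), p. 296] [cite: Skinner2016PacificMC, Thm. C (§1) and footnote 1]
[cite: HoffsteinLuo1997, Theorem (§1)] [cite: Mazur1978, Cor. 4.1] [cite: SilvermanAEC2009, Thm. X.4.2(a)]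
[cite: Mazur1977, Ch. III §5, p. 157] [cite: Miller2011LMS, §1 and Def. 1.1] -/
theorem bsdp_of_classX11b_of_ram_of_not_dvd_of_card_addSubgroup_selmer
    -- published inputs (named facts of the tree)
    (hGZ : ∀ (N : ℕ) [NeZero N] (W : WeierstrassCurve ℚ) (K : Type) [Field K] [NumberField K],
      gross_zagier N W K)
    (hKo : ∀ (N : ℕ) [NeZero N] (W : WeierstrassCurve ℚ) (K : Type) [Field K] [NumberField K],
      kolyvagin N W K)
    (hB : ∀ (N : ℕ) [NeZero N] (W : WeierstrassCurve ℚ) (K : Type) [Field K] [NumberField K],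
      Kolyvagin1990_padicValNat_card_sha_le N W K)
    (hSk : Skinner2016.thmC_padicValRat_bsd_rank_zero)
    (hGZK : rank_eq_analyticRank_of_analyticRank_le_one) (hmod : hasEntireLFunction_rat)
    (hnf : exists_isNewformOf) (hHL : HoffsteinLuo1997_exists_twist_L_one_ne_zero)
    (hMaz : mazur_not_dvd_maninConstant_of_odd) (hNS : integral_neronScaling_of_isGloballyMinimal)
    -- the pair, on the atom A1
    (W : WeierstrassCurve ℚ) [W.IsElliptic] [W.IsGloballyMinimal] (p : ℕ) [Fact p.Prime]
    (hX : ClassX11b W p) (hram : Ram W p) (htam0 : ¬ p ∣ W.tamagawaProduct)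
    -- the certificates: an exhibited Selmer subgroup of order `p^(1+j)`; `#Ш_an = s`, `ord_p s ≤ j`
    {j : ℕ} {S : AddSubgroup (W.galH1Torsion (p : ℤ))} (hS : S ≤ W.selmerGroup (p : ℤ))
    (hcardS : Nat.card S = p ^ (1 + j)) {s : ℚ} (hs : shaAn W = (s : ℂ))
    (hv : padicValRat p s ≤ j) : BSDp W p := by
  obtain ⟨hrk, -⟩ := hGZK W (le_of_eq hX.1)
  have hirr : Irr W p := hX.2.2.2
  -- LOWER certificate `p^j ∣ #Ш(E/ℚ)` from the exhibited subgroup (no rational `p`-torsion: Mazur)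
  have hdvd : p ^ j ∣ W.shaOrder :=
    pow_dvd_shaOrder_of_card_addSubgroup_selmerGroup W p (j := j) hS (by rw [hrk, hX.1]; exact hcardS)
      ((natCard_torsionBy_point_eq_of_subsingleton W _ _ _).trans
        (natCard_torsionBy_eq_one_of_hasIrreducibleModPGaloisRep W p hirr))
  exact bsdp_of_classX11b_of_ram_of_not_dvd_of_pow_dvd hGZ hKo hB hSk hGZK hmod hnf hHL hMaz hNS W p hX
    hram htam0 hdvd hs hv

end AtomA1

/-! ### §3. The `p = 3` rows: `#Ш_an = 9`, an exhibited subgroup of `Sel^(3)(E/ℚ)` of order `27` -/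

section Three

/-- **X11b at `p = 3` with `ρ̄_{E,3}` onto and `#Ш_an = 9·(3-adic unit)`: `BSD(E,3)` from PUBLISHED
theorems (Kolyvagin via McCallum/Gross; GZK) plus the lane's Heegner-index certificate
`ord₃ [E(K) : ℤ y_K] ≤ 1` and an EXHIBITED subgroup of `Sel^(3)(E/ℚ)` of order `27`** (the LB3+KOLY
rows of the closing table, index road; `ClassX11b W 3` supplies `r_an = 1`). Per pair; X11 ∧ `r = 1`
∧ `p = 3` stays CONSTRUCTION-SHAPED (R6.2); nothing booked.
[cite: McCallumLMS1991, §1 Theorem (Kolyvagin), p. 296] [cite: SilvermanAEC2009, Thm. X.4.2(a)]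
[cite: Miller2011LMS, §1 and Def. 1.1] -/
theorem ClassX11b.bsdp_three_of_kolyvagin_of_card_addSubgroup_selmerThree
    (W : WeierstrassCurve ℚ) [W.IsElliptic]
    (hGZK : rank_eq_analyticRank_of_analyticRank_le_one) (hX : ClassX11b W 3)
    {N : ℕ} [NeZero N] {K : Type} [Field K] [NumberField K] (hKo : kolyvagin N W K)
    (hB : Kolyvagin1990_padicValNat_card_sha_le N W K) (hK : IsImaginaryQuadratic K)
    (hH : SatisfiesHeegnerHypothesis N K) {P : (W.baseChange K).toAffine.Point}
    (hP : IsHeegnerPoint N W K P) (hnt : ¬ IsOfFinAddOrder P) (hρ : Surj W 3)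
    (hI : padicValNat 3 (AddSubgroup.zmultiples P).index ≤ 1)
    {s : ℚ} (hs : shaAn W = (s : ℂ)) (hv : padicValRat 3 s = 2)
    {S : AddSubgroup (W.galH1Torsion (3 : ℤ))} (hS : S ≤ W.selmerGroup (3 : ℤ))
    (hcardS : Nat.card S = 27) : BSDp W 3 :=
  bsdp_of_kolyvagin_of_card_addSubgroup_selmer W 3 hGZK hKo hB hK hH hP hnt hX.2.1 hρ hI hX.1 hs hv
    (S := S) (by simpa using hS) (hcardS.trans (by norm_num))

/-- **X11 at `p = 3`, rank one (`IsX11Three`), on the atom A1 ((ram) ∧ `3 ∤ ∏c_ℓ`), `#Ш_an = s` with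
`ord₃ s ≤ j`: `BSD(E,3)` from PUBLISHED theorems plus ONE certificate — an EXHIBITED subgroup of
`Sel^(3)(E/ℚ)` of order `3^(1+j)`; NO index, NO partner, NO Cassels–Tate, NO class-group
certification** (`bsdp_of_classX11b_of_ram_of_not_dvd_of_card_addSubgroup_selmer` at `p = 3`). The
LB3 rows are `j = 2`, `#S = 27` (next theorem). Per pair; nothing booked; X11 ∧ `r = 1` ∧ `p = 3`
stays CONSTRUCTION-SHAPED (REFEREE R6.2).
[cite: McCallumLMS1991, §1 Theorem (Kolyvagin), p. 296] [cite: Skinner2016PacificMC, Thm. C (§1) and footnote 1]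
[cite: SilvermanAEC2009, Thm. X.4.2(a)] [cite: Miller2011LMS, §1 and Def. 1.1] -/
theorem IsX11Three.bsdp_of_ram_of_not_dvd_of_card_addSubgroup_selmerThree
    -- published inputs (named facts of the tree)
    (hGZ : ∀ (N : ℕ) [NeZero N] (W : WeierstrassCurve ℚ) (K : Type) [Field K] [NumberField K],
      gross_zagier N W K)
    (hKo : ∀ (N : ℕ) [NeZero N] (W : WeierstrassCurve ℚ) (K : Type) [Field K] [NumberField K],
      kolyvagin N W K)
    (hB : ∀ (N : ℕ) [NeZero N] (W : WeierstrassCurve ℚ) (K : Type) [Field K] [NumberField K],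
      Kolyvagin1990_padicValNat_card_sha_le N W K)
    (hSk : Skinner2016.thmC_padicValRat_bsd_rank_zero)
    (hGZK : rank_eq_analyticRank_of_analyticRank_le_one) (hmod : hasEntireLFunction_rat)
    (hnf : exists_isNewformOf) (hHL : HoffsteinLuo1997_exists_twist_L_one_ne_zero)
    (hMaz : mazur_not_dvd_maninConstant_of_odd) (hNS : integral_neronScaling_of_isGloballyMinimal)
    -- the pair, on the atom A1 at `p = 3`
    (W : WeierstrassCurve ℚ) [W.IsElliptic] [W.IsGloballyMinimal] (hX : IsX11Three W)
    (hram : Ram W 3) (htam0 : ¬ 3 ∣ W.tamagawaProduct)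
    -- the certificates
    {j : ℕ} {S : AddSubgroup (W.galH1Torsion (3 : ℤ))} (hS : S ≤ W.selmerGroup (3 : ℤ))
    (hcardS : Nat.card S = 3 ^ (1 + j)) {s : ℚ} (hs : shaAn W = (s : ℂ))
    (hv : padicValRat 3 s ≤ j) : BSDp W 3 :=
  bsdp_of_classX11b_of_ram_of_not_dvd_of_card_addSubgroup_selmer hGZ hKo hB hSk hGZK hmod hnf hHL hMaz
    hNS W 3 (classX11b_three_of_isX11Three W hX) hram htam0 (j := j) (S := S) (by simpa using hS)
    hcardS hs hv

/-- **The LB3 rows on the atom A1 at `p = 3`, subgroup form: an EXHIBITED subgroup of `Sel^(3)(E/ℚ)`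
of order `27` and `ord₃ #Ш(E)_an ≤ 2` ⇒ `BSD(E,3)`** for `E` of analytic rank one, multiplicative at
`3`, `E[3]` irreducible, with a (ram) prime and `3 ∤ ∏c_ℓ(E)` — from PUBLISHED theorems and that ONE
certificate (three independent `3`-Selmer classes verified by local images; no `bnfcertify`, no
GRH, no Heegner index, no partner curve, no Cassels–Tate). EVIDENCE pointer (lane data + this unit's
tables, nothing booked here): all 33 `#Ш_an = 9` classes of the gen-10 TAIL of the lane's X11b@3
rank-one residue at `N < 5·10⁵` have this shape (`tail10/tail_strata.tsv`: atom A1, `surj(3)`, three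
classes exhibited by the gen-8 GRH census), among them the two the EXACT road could not certify
inside 48 h (`338919c1`, `433686p1`). Per pair; label unchanged.
[cite: McCallumLMS1991, §1 Theorem (Kolyvagin), p. 296] [cite: Skinner2016PacificMC, Thm. C (§1) and footnote 1]
[cite: SilvermanAEC2009, Thm. X.4.2(a)] [cite: Miller2011LMS, §1 and Def. 1.1] -/
theorem IsX11Three.bsdp_of_ram_of_not_dvd_of_card_addSubgroup_selmerThree_eq
    -- published inputs (named facts of the tree)
    (hGZ : ∀ (N : ℕ) [NeZero N] (W : WeierstrassCurve ℚ) (K : Type) [Field K] [NumberField K],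
      gross_zagier N W K)
    (hKo : ∀ (N : ℕ) [NeZero N] (W : WeierstrassCurve ℚ) (K : Type) [Field K] [NumberField K],
      kolyvagin N W K)
    (hB : ∀ (N : ℕ) [NeZero N] (W : WeierstrassCurve ℚ) (K : Type) [Field K] [NumberField K],
      Kolyvagin1990_padicValNat_card_sha_le N W K)
    (hSk : Skinner2016.thmC_padicValRat_bsd_rank_zero)
    (hGZK : rank_eq_analyticRank_of_analyticRank_le_one) (hmod : hasEntireLFunction_rat)
    (hnf : exists_isNewformOf) (hHL : HoffsteinLuo1997_exists_twist_L_one_ne_zero)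
    (hMaz : mazur_not_dvd_maninConstant_of_odd) (hNS : integral_neronScaling_of_isGloballyMinimal)
    (W : WeierstrassCurve ℚ) [W.IsElliptic] [W.IsGloballyMinimal] (hX : IsX11Three W)
    (hram : Ram W 3) (htam0 : ¬ 3 ∣ W.tamagawaProduct)
    {S : AddSubgroup (W.galH1Torsion (3 : ℤ))} (hS : S ≤ W.selmerGroup (3 : ℤ))
    (hcardS : Nat.card S = 27) {s : ℚ} (hs : shaAn W = (s : ℂ))
    (hv : padicValRat 3 s ≤ 2) : BSDp W 3 :=
  IsX11Three.bsdp_of_ram_of_not_dvd_of_card_addSubgroup_selmerThree hGZ hKo hB hSk hGZK hmod hnf hHL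
    hMaz hNS W hX hram htam0 (j := 2) hS (by rw [hcardS]; norm_num) hs (by exact_mod_cast hv)

/-- **The same in the vocabulary of the typed class `ClassX11 W 3`** (`mult(3) ∧ irr(3) ∧ …`) at
analytic rank one: on the atom A1, an exhibited subgroup of `Sel^(3)(E/ℚ)` of order `3^(1+j)` and
`ord₃ #Ш(E)_an ≤ j` ⇒ `BSD(E,3)`. Per pair; nothing booked; X11 ∧ `r = 1` ∧ `p = 3` stays
CONSTRUCTION-SHAPED. [cite: McCallumLMS1991, §1 Theorem (Kolyvagin), p. 296]
[cite: Skinner2016PacificMC, Thm. C (§1) and footnote 1] [cite: SilvermanAEC2009, Thm. X.4.2(a)]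
[cite: Miller2011LMS, §1 and Def. 1.1] -/
theorem X11.bsdp_three_of_ram_of_not_dvd_of_card_addSubgroup_selmerThree
    -- published inputs (named facts of the tree)
    (hGZ : ∀ (N : ℕ) [NeZero N] (W : WeierstrassCurve ℚ) (K : Type) [Field K] [NumberField K],
      gross_zagier N W K)
    (hKo : ∀ (N : ℕ) [NeZero N] (W : WeierstrassCurve ℚ) (K : Type) [Field K] [NumberField K],
      kolyvagin N W K)
    (hB : ∀ (N : ℕ) [NeZero N] (W : WeierstrassCurve ℚ) (K : Type) [Field K] [NumberField K],
      Kolyvagin1990_padicValNat_card_sha_le N W K)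
    (hSk : Skinner2016.thmC_padicValRat_bsd_rank_zero)
    (hGZK : rank_eq_analyticRank_of_analyticRank_le_one) (hmod : hasEntireLFunction_rat)
    (hnf : exists_isNewformOf) (hHL : HoffsteinLuo1997_exists_twist_L_one_ne_zero)
    (hMaz : mazur_not_dvd_maninConstant_of_odd) (hNS : integral_neronScaling_of_isGloballyMinimal)
    (W : WeierstrassCurve ℚ) [W.IsElliptic] [W.IsGloballyMinimal] (hX : ClassX11 W 3)
    (hr : W.analyticRank = 1) (hram : Ram W 3) (htam0 : ¬ 3 ∣ W.tamagawaProduct)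
    {j : ℕ} {S : AddSubgroup (W.galH1Torsion (3 : ℤ))} (hS : S ≤ W.selmerGroup (3 : ℤ))
    (hcardS : Nat.card S = 3 ^ (1 + j)) {s : ℚ}
    (hs : shaAn W = (s : ℂ)) (hv : padicValRat 3 s ≤ j) : BSDp W 3 :=
  IsX11Three.bsdp_of_ram_of_not_dvd_of_card_addSubgroup_selmerThree hGZ hKo hB hSk hGZK hmod hnf hHL
    hMaz hNS W ⟨hX.1, hX.2.1, hr⟩ hram htam0 hS hcardS hs hv

end Three

end Summit.BirchSwinnertonDyer.Rank1Residual.X11b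

end
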